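import Mathlib
import Summits.ValiantsHypothesis.ValiantsHypothesis.Theorems.BorderApolarityToricWitnessObstructionQPBorder33

/-!
# Border apolarity, crux `ToricWitnessObstructionQP` — approximate determinantal representations
# of any order are border determinantal expressions (the bdc certificate checker; lead c7)

Route `ValiantsHypothesis/BorderApolarity`, crux item `stmt-ValiantsHypothesis-14753`, line `Sketch`.
Companion of `…QPDecompression.lean` and of the crux note `GradedNormalForm.md` (Cor. 3.1): an
*approximate determinantal representation of order `k`* of `P` is a matrix
`A = B₀ + X·B₁ + ⋯ + X^k·B_k` of linear forms `B_j` in the `m²` variables with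
`[X^t] det A = 0` for `t < k` and `[X^k] det A = P`.  This file proves the elementary fact that then
`P ∈ Δ[det_m]` (the orbit closure of `det_m`), i.e. `bdc(P) ≤ m`: the rescaled linear determinants
`s^{-k} · det A(s)` (`s = 1/(t+1) → 0`) are points of `End · det_m ⊆ Δ[det_m]` and converge to `P`
coefficientwise, and Euclidean limits stay in `Δ` (tree: `Border33.mem_orbitClosure_of_tendsto_of_mem`).
It is the kernel-checkable certificate lane for any exact hit of the order-1 splitting search
`J1(5)/J1(6)` of this seat (which would give `bdc(x₀₀³per₃) ≤ 6 < 7 = dc(per₃)`), and complements the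
tree's de-bordering `determinantalComplexity_perPoly_le_of_orderRep` (same hypothesis shape).

* `coeff_det_layers_mem_orbitClosure`.
-/

open MvPolynomial Filter Topology
open scoped Polynomial BigOperators

-- the mandated summit-side namespace repeats a component by design (single-problem summit)
set_option linter.dupNamespace false

namespace Summit.ValiantsHypothesis.ValiantsHypothesis.Theorems.BorderApolarityToricWitnessObstructionQP

noncomputable section

namespace OrderRep

open Literature.Computability.AlgebraicComplexity
open Border33 (det_eq_linSubst_detPoly mem_orbitClosure_of_tendsto_of_mem)

/-- Evaluating the layer matrix `A = Σ_j X^j B_j` at a scalar `X := s` gives the matrix of linear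
forms `Σ_j s^j B_j`. [folklore] -/
theorem eval_layers {m : ℕ} (k : ℕ) (B : ℕ → Matrix (Fin m) (Fin m) (MvPolynomial (Fin m × Fin m) ℂ))
    (s : ℂ) (a b : Fin m) :
    Polynomial.eval (C s) (∑ j ∈ Finset.range (k + 1), Polynomial.monomial j (B j a b)) =
      ∑ j ∈ Finset.range (k + 1), C (s ^ j) * B j a b := by
  rw [Polynomial.eval_finsetSum]
  refine Finset.sum_congr rfl fun j _ => ?_
  rw [Polynomial.eval_monomial, map_pow, mul_comm]

/-- **Approximate determinantal representations are border determinantal expressions.**  If the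
`B_j` are matrices of linear forms in the `m²` variables and the determinant of
`A = Σ_{j ≤ k} X^j B_j` has vanishing coefficients below `X^k`, then its `X^k`-coefficient lies in the
orbit closure `Δ[det_m]`. [folklore] -/
theorem coeff_det_layers_mem_orbitClosure {m : ℕ} [NeZero m] (k : ℕ)
    (B : ℕ → Matrix (Fin m) (Fin m) (MvPolynomial (Fin m × Fin m) ℂ))
    (hB : ∀ j a b, (B j a b).IsHomogeneous 1)
    (hlow : ∀ t < k, (Matrix.det (Matrix.of fun a b =>
        ∑ j ∈ Finset.range (k + 1), Polynomial.monomial j (B j a b))).coeff t = 0) :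
    (Matrix.det (Matrix.of fun a b =>
        ∑ j ∈ Finset.range (k + 1), Polynomial.monomial j (B j a b))).coeff k
      ∈ orbitClosure (detPoly (Fin m) ℂ) := by
  classical
  set A : Matrix (Fin m) (Fin m) (Polynomial (MvPolynomial (Fin m × Fin m) ℂ)) :=
    Matrix.of fun a b => ∑ j ∈ Finset.range (k + 1), Polynomial.monomial j (B j a b) with hA
  set P := A.det with hP
  set N := P.natDegree with hN
  -- the evaluated matrices of linear forms and their row-0 rescalings
  let As : ℂ → Matrix (Fin m) (Fin m) (MvPolynomial (Fin m × Fin m) ℂ) := fun s =>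
    A.map (Polynomial.eval (C s))
  have hAs : ∀ s a b, As s a b = ∑ j ∈ Finset.range (k + 1), C (s ^ j) * B j a b := by
    intro s a b
    simp only [As, Matrix.map_apply, hA, Matrix.of_apply]
    exact eval_layers k B s a b
  have hAsh : ∀ s a b, (As s a b).IsHomogeneous 1 := by
    intro s a b
    rw [hAs]
    refine IsHomogeneous.sum _ _ _ fun j _ => ?_
    exact (hB j a b).C_mul _
  let Ms : ℂ → Matrix (Fin m) (Fin m) (MvPolynomial (Fin m × Fin m) ℂ) := fun s =>
    (As s).updateRow 0 ((C ((s ^ k)⁻¹) : MvPolynomial (Fin m × Fin m) ℂ) • (As s) 0)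
  have hMsh : ∀ s i j, (Ms s i j).IsHomogeneous 1 := by
    intro s i j
    simp only [Ms]
    by_cases hi : i = 0
    · subst hi
      rw [Matrix.updateRow_self, Pi.smul_apply, smul_eq_mul]
      exact (hAsh s 0 j).C_mul _
    · rw [Matrix.updateRow_ne hi]
      exact hAsh s i j
  -- determinant of the evaluation = evaluation of the determinant = Σ_t s^t P_t
  have hdetAs : ∀ s, (As s).det = ∑ t ∈ Finset.range (N + 1), C (s ^ t) * P.coeff t := by
    intro s
    have h1 : (As s).det = Polynomial.eval (C s) P := by
      simp only [As, hP]
      rw [show A.map (Polynomial.eval (C s)) =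
          (Polynomial.evalRingHom (C s) : Polynomial (MvPolynomial (Fin m × Fin m) ℂ) →+* _).mapMatrix A
          from rfl, ← RingHom.map_det]
      rfl
    rw [h1, Polynomial.eval_eq_sum_range, hN]
    refine Finset.sum_congr rfl fun t _ => ?_
    rw [map_pow, mul_comm]
  have hdetMs : ∀ s, (Ms s).det = ∑ t ∈ Finset.range (N + 1), C ((s ^ k)⁻¹ * s ^ t) * P.coeff t := by
    intro s
    simp only [Ms]
    rw [Matrix.det_updateRow_smul, Matrix.updateRow_eq_self, hdetAs, Finset.mul_sum]
    refine Finset.sum_congr rfl fun t _ => ?_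
    rw [← mul_assoc, ← map_mul]
  -- each rescaled determinant lies in the orbit closure of `det_m`
  have hmem : ∀ s, (Ms s).det ∈ orbitClosure (detPoly (Fin m) ℂ) := by
    intro s
    refine endOrbit_subset_orbitClosure_holds _ ?_
    exact ⟨_, (det_eq_linSubst_detPoly (Ms s) (hMsh s)).symm⟩
  -- along `s = 1/(t+1) → 0` they converge coefficientwise to `P_k`
  have hlim : Tendsto (fun t : ℕ => coeffVec ((Ms (((t : ℂ) + 1)⁻¹)).det)) atTop
      (𝓝 (coeffVec (P.coeff k))) := by
    rw [tendsto_pi_nhds]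
    intro d
    simp only [coeffVec_apply]
    have hrw : ∀ t : ℕ, coeff d ((Ms (((t : ℂ) + 1)⁻¹)).det) =
        ∑ j ∈ Finset.range (N + 1), (((((t : ℂ) + 1)⁻¹) ^ k)⁻¹ * (((t : ℂ) + 1)⁻¹) ^ j) *
          coeff d (P.coeff j) := by
      intro t
      rw [hdetMs, coeff_sum]
      refine Finset.sum_congr rfl fun j _ => ?_
      rw [coeff_C_mul]
    simp_rw [hrw]
    -- the target as the same finite sum with limiting weights `[j = k]` (for `j ≥ k`; `P_j = 0` for `j < k`)
    have hPlow : ∀ j < k, P.coeff j = 0 := fun j hj => hlow j hj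
    have htarget : coeff d (P.coeff k) =
        ∑ j ∈ Finset.range (N + 1), (if j = k then 1 else 0) * coeff d (P.coeff j) := by
      simp only [ite_mul, one_mul, zero_mul]
      rw [Finset.sum_ite_eq']
      split_ifs with hk
      · rfl
      · -- k > N: the coefficient vanishes
        have hkN : N < k := by
          rw [Finset.mem_range, not_lt] at hk; omega
        rw [hN] at hkN
        rw [Polynomial.coeff_eq_zero_of_natDegree_lt hkN, coeff_zero]
    rw [htarget]
    refine tendsto_finsetSum _ fun j hj => ?_
    have hne : ∀ t : ℕ, ((t : ℂ) + 1) ≠ 0 := fun t => by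
      rw [← Nat.cast_succ]; exact Nat.cast_ne_zero.2 (Nat.succ_ne_zero t)
    rcases lt_trichotomy j k with hjk | hjk | hjk
    · -- j < k : `P_j = 0`, both sides are the zero sequence / zero
      have h0 : coeff d (P.coeff j) = 0 := by rw [hPlow j hjk, coeff_zero]
      simp only [h0, mul_zero]
      exact tendsto_const_nhds
    · subst hjk
      refine Tendsto.mul_const _ ?_
      simp only [if_true]
      refine tendsto_const_nhds.congr' ?_
      filter_upwards [Filter.eventually_ge_atTop 0] with t _
      have hne' : (((t : ℂ) + 1)⁻¹) ^ j ≠ 0 := pow_ne_zero _ (inv_ne_zero (hne t))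
      rw [inv_mul_cancel₀ hne']
    · refine Tendsto.mul_const _ ?_
      rw [if_neg hjk.ne']
      obtain ⟨i, hi⟩ : ∃ i, j = k + i := ⟨j - k, by omega⟩
      have hi0 : 0 < i := by omega
      have h1 : Tendsto (fun t : ℕ => (1 / ((t : ℝ) + 1))) atTop (𝓝 0) :=
        tendsto_one_div_add_atTop_nhds_zero_nat
      have h2 : Tendsto (fun t : ℕ => ((1 / ((t : ℝ) + 1)) ^ i : ℝ)) atTop (𝓝 0) := by
        have := h1.pow i
        rwa [zero_pow hi0.ne'] at this
      have h3 : Tendsto (fun t : ℕ => (((1 / ((t : ℝ) + 1)) ^ i : ℝ) : ℂ)) atTop (𝓝 0) := by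
        have := (Complex.continuous_ofReal.tendsto 0).comp h2
        rwa [Complex.ofReal_zero] at this
      refine h3.congr fun t => ?_
      rw [hi, pow_add, ← mul_assoc, inv_mul_cancel₀ (pow_ne_zero _ (inv_ne_zero (hne t))), one_mul]
      push_cast
      rw [one_div]
  exact mem_orbitClosure_of_tendsto_of_mem (fun t : ℕ => (Ms (((t : ℂ) + 1)⁻¹)).det)
    (fun t => hmem _) hlim

end OrderRep

/-- **Approximate determinantal representations of any order are border determinantal expressions
(registered helper form).**  `[X^t] det(Σ_{j≤k} X^j B_j) = 0` for `t < k`, `B_j` linear forms in the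
`m²` variables ⟹ `[X^k] det(Σ_{j≤k} X^j B_j) ∈ Δ[det_m]` (`OrderRep.coeff_det_layers_mem_orbitClosure`).
[folklore] -/
theorem coeff_det_layers_mem_orbitClosure : ∀ {m : ℕ} [NeZero m] (k : ℕ) (B : ℕ → Matrix (Fin m) (Fin m) (MvPolynomial (Fin m × Fin m) ℂ)), (∀ j a b, (B j a b).IsHomogeneous 1) → (∀ t < k, (Matrix.det (Matrix.of fun a b => ∑ j ∈ Finset.range (k + 1), Polynomial.monomial j (B j a b))).coeff t = 0) → (Matrix.det (Matrix.of fun a b => ∑ j ∈ Finset.range (k + 1), Polynomial.monomial j (B j a b))).coeff k ∈ Literature.Computability.AlgebraicComplexity.orbitClosure (Literature.Computability.AlgebraicComplexity.detPoly (Fin m) ℂ) :=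
  fun k B hB hlow => OrderRep.coeff_det_layers_mem_orbitClosure k B hB hlow

end

end Summit.ValiantsHypothesis.ValiantsHypothesis.Theorems.BorderApolarityToricWitnessObstructionQP
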